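import Mathlib.Combinatorics.SimpleGraph.Coloring.Constructions
import Summits.CriticalPhenomena.PercolationContinuityZ3.Theorems.PercNearOneGluingNoHeavyLowerTailSunflowerBipartiteCorollaries
import HarnessLib
import HarnessLib.Audit

/-!
# `NoHeavyLowerTail` (crux stmt-CriticalPhenomena-4575), abstract sunflower cubic: THE WEIGHTED (SYMMETRISED POLARISED) INEQUALITY
# IMPLIES A-SAFETY FOR EVERY GRAPH CORE; its TERMWISE form relative to a conditioned vertex set; the typed target for the ODD CYCLES

Support file (seat `prim-ineq-prove-1` gen 70; `--supports stmt-CriticalPhenomena-4575`).  No `sorry`, no named facts.  The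
`@[conjecture]` definition is an obligation of this programme (census-true, unproved), used only as an explicit hypothesis.
Memo: run/shared/lean/prim/prim-ineq-prove-1/FINDING-POLARISED-prove1-g70.md.

Gen 40 proved `Bridge.safe_edgeCore_of_bipartite` by the chain
polarisation (`prod_real_eq_sum_wprof`, `sum_wprof_le_of_fibrewise`) → symmetrisation (`polarised_of_weighted`) → the WEIGHTED
inequality `Σ_{S ∈ confs m, BAD} (K − |J S|)! ≤ (K−1)! · #{S ∈ confs m | GOOD}` on every profile fibre (`weighted_of_bipartite`, from
the type-model lemma by conditioning on one side).  Only the last step uses bipartiteness.  This file isolates the graph-independent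
part:
* `WeightedIneq Γ` — the weighted inequality for the graph core of `Γ`, for every number of slots, every family of up-sets meeting
  pairwise inside the core and every profile; **`safe_edgeCore_of_weightedIneq`**: `WeightedIneq Γ → ∀ p, Safe p (edgeCore Γ)`
  (the gen-40 assembly, verbatim); `weightedIneq_of_bipartite` (gen 40's theorem in this language).
* `TermWeightedIneq Γ L` — the same inequality on every TERM, i.e. on every fibre of the restriction `resL L` of the slot
  assignment to a vertex set `L` (the rows' `L`-parts are frozen); **`weightedIneq_of_termWeightedIneq`** (sum over the terms).
* the typed target **`OddCycleTermWeighted`**: for every odd cycle `C_{2k+3}` (`k ≥ 1`) the termwise inequality holds for the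
  conditioned set `oddCond k = {3, 5, …, 2k+1}` (all odd vertices except `1`, so that the path `2k+2 – 0 – 1 – 2` stays free); and
  **`safe_edgeCore_oddCycle_of_termWeighted`**: under it every odd cycle `C_n`, `n ≥ 5`, has an A-safe core.
EVIDENCE (memo §3): exact census — `C₅` (`K ≤ 5`), `C₇` (`K ≤ 4`, `K = 5` for multiplicities `≤ 2`), `C₉` (`K = 3` sampled
families, `K = 4` multiplicities `≤ 2`), `C₁₁` (`K = 3`, multiplicities `≤ 2`): no failing term; whereas the termwise inequality FAILS
for every conditioned set containing or adjacent on both sides to the "defect" (e.g. all odd vertices; `{0,1,3,…}`), which is why the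
one-side conditioning of gen 40 cannot be used for odd cycles (memo FINDING-BIPARTITE-prove1-g40.md §3 remark (a)).
-/

namespace Summit.CriticalPhenomena.PercolationContinuityZ3.Theorems.SunflowerPartition

namespace Bridge

open Finset MeasureTheory Literature.Probability.LatticeModels Literature.Probability.Percolation

variable {n : ℕ}

/-! ### The weighted inequality as a property of a graph, and the graph-independent assembly -/

open scoped Classical in
/-- **`WeightedIneq Γ`**: for every number `K` of slots, every family `V` of up-sets meeting pairwise inside `edgeCore Γ` and every
profile `m`, the weighted (symmetrised polarised) inequality `Σ_{S ∈ confs m, BAD} (K − |J S|)! ≤ (K−1)! · #{S ∈ confs m | GOOD}`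
(`BadG`/`GoodG`/`J` of `…SunflowerBipartiteSymmetrisation`, petals `Wof Γ V k = V k ∖ edgeCore Γ`). [this work] -/
def WeightedIneq (Γ : SimpleGraph (Fin n)) : Prop :=
  ∀ (K : ℕ) (V : Fin K → Set (Set (Fin n))), (∀ k, IsUpperSet (V k)) →
    (∀ i j, i ≠ j → V i ∩ V j ⊆ SafeCalc.edgeCore Γ) → ∀ m : Fin n → ℕ,
      ∑ S ∈ (TypeModel.Model.confs m).filter (fun S => BadG (SafeCalc.edgeCore Γ) (Wof Γ V) S),
          (K - (J (SafeCalc.edgeCore Γ) S).card).factorial ≤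
        (K - 1).factorial * ((TypeModel.Model.confs m).filter fun S => GoodG (SafeCalc.edgeCore Γ) (Wof Γ V) S).card

open scoped Classical in
/-- **The weighted inequality implies A-safety** (the gen-40 assembly with the bipartite input replaced by the hypothesis):
polarisation of both sides of Lemma A, fibrewise comparison, symmetrisation. [this work] -/
theorem safe_edgeCore_of_weightedIneq (Γ : SimpleGraph (Fin n)) (hW : WeightedIneq Γ) (p : Fin n → unitInterval) :
    SafeCalc.Safe p (SafeCalc.edgeCore Γ) := by
  classical
  intro K V hV hcap
  set A := SafeCalc.edgeCore Γ with hA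
  rcases Nat.eq_zero_or_pos K with hK | hK
  · subst hK; simp
  -- the free slot
  set last : Fin K := ⟨K - 1, by omega⟩ with hlast
  have hPD : PetalData A (Wof Γ V) := petalData_Wof Γ V hcap
  -- polarisation of the left-hand side
  rw [prod_real_eq_sum_wprof p V]
  -- the right-hand side as a product over the family `V''`
  set V'' : Fin K → Set (Set (Fin n)) := fun k => if k = last then Set.univ else A with hV''
  have hrhs : ((prodBernoulli p).real A) ^ (K - 1) = ∏ k, (prodBernoulli p).real (V'' k) := by
    have e : (fun k => (prodBernoulli p).real (V'' k)) =
        fun k => if k = last then (prodBernoulli p).real (Set.univ : Set (Set (Fin n))) else (prodBernoulli p).real A := by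
      funext k; by_cases hk : k = last <;> simp [hV'', hk]
    rw [e, Finset.prod_ite, Finset.prod_const, Finset.prod_const, probReal_univ, one_pow, one_mul]
    congr 1
    have : (Finset.univ.filter fun k : Fin K => ¬ k = last) = Finset.univ.erase last := by
      ext k; simp
    rw [this, Finset.card_erase_of_mem (Finset.mem_univ _), Finset.card_univ, Fintype.card_fin]
  rw [hrhs, prod_real_eq_sum_wprof p V'']
  have hQ : ∀ S : Fin n → Finset (Fin K), (∀ k, row S k ∈ V'' k) ↔ (∀ k, k ≠ last → row S k ∈ A) := by
    intro S
    refine forall_congr' fun k => ?_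
    by_cases hk : k = last <;> simp [hV'', hk]
  simp_rw [hQ]
  -- fibrewise comparison
  refine sum_wprof_le_of_fibrewise p _ _ fun m => ?_
  calc ((TypeModel.Model.confs m).filter fun S => ∀ k, row S k ∈ V k).card
      ≤ ((TypeModel.Model.confs m).filter fun S => ∀ k, row S k ∈ A ∪ Wof Γ V k).card := by
        refine Finset.card_le_card (Finset.monotone_filter_right _ fun S _ h k => ?_)
        by_cases hkA : row S k ∈ A
        · exact Or.inl hkA
        · exact Or.inr ⟨h k, hkA⟩
    _ ≤ ((TypeModel.Model.confs m).filter fun S => ∀ k, k ≠ last → row S k ∈ A).card := by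
        have hw := hW K V hV hcap m
        convert polarised_of_weighted hPD m last (by convert hw using 2) using 2

/-- Gen 40's theorem in this language: a bipartite graph satisfies the weighted inequality. [this work] -/
theorem weightedIneq_of_bipartite (Γ : SimpleGraph (Fin n)) (L : Finset (Fin n))
    (hL : ∀ u v, Γ.Adj u v → (u ∈ L ↔ v ∉ L)) : WeightedIneq Γ :=
  fun _ V hV hcap m => weighted_of_bipartite Γ L V ⟨hL, hV, hcap⟩ m

/-! ### The termwise form relative to a conditioned vertex set -/

open scoped Classical in
/-- **`TermWeightedIneq Γ L`**: the weighted inequality on every TERM — every fibre of `resL L` (the `L`-parts of all rows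
frozen) inside every profile fibre.  It trivially implies `WeightedIneq Γ` (`weightedIneq_of_termWeightedIneq`); an injection
proving it may only move the vertices outside `L` between rows. [this work] -/
def TermWeightedIneq (Γ : SimpleGraph (Fin n)) (L : Finset (Fin n)) : Prop :=
  ∀ (K : ℕ) (V : Fin K → Set (Set (Fin n))), (∀ k, IsUpperSet (V k)) →
    (∀ i j, i ≠ j → V i ∩ V j ⊆ SafeCalc.edgeCore Γ) → ∀ (m : Fin n → ℕ) (S₀ : Fin n → Finset (Fin K)),
      ∑ S ∈ ((TypeModel.Model.confs m).filter fun S => resL L S = resL L S₀).filter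
            (fun S => BadG (SafeCalc.edgeCore Γ) (Wof Γ V) S),
          (K - (J (SafeCalc.edgeCore Γ) S).card).factorial ≤
        (K - 1).factorial *
          (((TypeModel.Model.confs m).filter fun S => resL L S = resL L S₀).filter
            fun S => GoodG (SafeCalc.edgeCore Γ) (Wof Γ V) S).card

open scoped Classical in
/-- **Termwise ⟹ global**: summing the termwise inequality over the terms (the fibres of `resL L`) gives `WeightedIneq Γ`.
[this work] -/
theorem weightedIneq_of_termWeightedIneq (Γ : SimpleGraph (Fin n)) (L : Finset (Fin n))
    (hT : TermWeightedIneq Γ L) : WeightedIneq Γ := by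
  classical
  intro K V hV hcap m
  set A := SafeCalc.edgeCore Γ with hA
  set C := TypeModel.Model.confs (ι := Fin n) (K := K) m with hC
  set keys := C.image (resL L) with hkeys
  have hmaps : ∀ S ∈ C, resL L S ∈ keys := fun S hS => Finset.mem_image_of_mem _ hS
  -- regroup both sides over the keys
  have lhs : ∑ S ∈ C.filter (fun S => BadG A (Wof Γ V) S), (K - (J A S).card).factorial =
      ∑ SL ∈ keys, ∑ S ∈ (C.filter fun S => resL L S = SL),
        (if BadG A (Wof Γ V) S then (K - (J A S).card).factorial else 0) := by
    rw [Finset.sum_filter, ← Finset.sum_fiberwise_of_maps_to hmaps]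
  have rhs : ((C.filter fun S => GoodG A (Wof Γ V) S).card : ℕ) =
      ∑ SL ∈ keys, ((C.filter fun S => resL L S = SL).filter fun S => GoodG A (Wof Γ V) S).card := by
    rw [Finset.card_filter, ← Finset.sum_fiberwise_of_maps_to hmaps]
    refine Finset.sum_congr rfl fun SL _ => ?_
    rw [Finset.card_filter]
  rw [lhs, rhs, Finset.mul_sum]
  refine Finset.sum_le_sum fun SL hSL => ?_
  obtain ⟨S₀, hS₀, rfl⟩ := Finset.mem_image.1 hSL
  have h := hT K V hV hcap m S₀
  rw [Finset.sum_filter] at h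
  exact h

/-! ### The typed target for the odd cycles -/

/-- The conditioned vertex set for the odd cycle `C_{2k+3}` on `Fin (2k+3)`: the odd vertices `3, 5, …, 2k+1` (every odd vertex
except `1`), so that the free vertices are the even ones together with `1`, and the only edges among free vertices form the path
`(2k+2) – 0 – 1 – 2`. [this work] -/
def oddCond (k : ℕ) : Finset (Fin (2 * k + 3)) :=
  Finset.univ.filter fun v => v.val % 2 = 1 ∧ 3 ≤ v.val

/-- **TYPED TARGET (`OddCycleTermWeighted`)** (memo §3–§5): for every odd cycle `C_{2k+3}`, `k ≥ 1` (i.e. `C₅, C₇, …`), the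
weighted inequality holds termwise for the conditioned set `oddCond k`.  Census-true (memo §3); it FAILS for the conditioned sets
"all odd vertices" and `{0, 1} ∪ oddCond k` (memo §2), and it implies that every odd cycle has an A-safe core
(`safe_edgeCore_oddCycle_of_termWeighted`). [this work] -/
@[conjecture] def OddCycleTermWeighted : Prop :=
  ∀ k : ℕ, 1 ≤ k → TermWeightedIneq (SimpleGraph.cycleGraph (2 * k + 3)) (oddCond k)

/-- Under `OddCycleTermWeighted`, every odd cycle `C_{2k+3}` (`k ≥ 1`) has an A-safe graph core. [this work] -/
theorem safe_edgeCore_oddCycle_of_termWeighted (h : OddCycleTermWeighted) (k : ℕ) (hk : 1 ≤ k)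
    (p : Fin (2 * k + 3) → unitInterval) : SafeCalc.Safe p (SafeCalc.edgeCore (SimpleGraph.cycleGraph (2 * k + 3))) :=
  safe_edgeCore_of_weightedIneq _ (weightedIneq_of_termWeightedIneq _ _ (h k hk)) p

/-- Under `OddCycleTermWeighted`, every cycle `C_n` with `n ≥ 5` has an A-safe graph core (even cycles are bipartite:
`safe_edgeCore_of_isBipartite`; `C₄` is bipartite as well, and `C₃` is a triangle, never A-safe). [this work] -/
theorem safe_edgeCore_cycleGraph_of_termWeighted (h : OddCycleTermWeighted) (N : ℕ) (hN : 5 ≤ N)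
    (p : Fin N → unitInterval) : SafeCalc.Safe p (SafeCalc.edgeCore (SimpleGraph.cycleGraph N)) := by
  rcases Nat.even_or_odd N with hev | hodd
  · -- even cycles are bipartite
    have hcol : (SimpleGraph.cycleGraph N).Colorable 2 := by
      simpa using (SimpleGraph.cycleGraph.bicoloring_of_even N hev).colorable
    exact safe_edgeCore_of_isBipartite _ hcol p
  · obtain ⟨k, hk⟩ := hodd
    obtain ⟨j, rfl⟩ : ∃ j, N = 2 * j + 3 := ⟨k - 1, by omega⟩
    exact safe_edgeCore_oddCycle_of_termWeighted h j (by omega) p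

end Bridge

end Summit.CriticalPhenomena.PercolationContinuityZ3.Theorems.SunflowerPartition
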